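import Literature.Analysis.FluidPDE.TaoMainEstimateShellStep
import HarnessLib

/-!
# From a bounded set to a small ball: the time and space pigeonholes of Tao's Thm. 5.1
# for a general bounded set (the truncated cylindrical cells of Palasek's Prop. 11)

Analysis/FluidPDE proof file (theorems only, no definitions, no named facts), a step of the
inline programme for `Literature.Analysis.FluidPDE.palasek2021_axisym_quantitative_ess`
(S. Palasek, *Improved quantitative regularity for the Navier–Stokes equations in a scale of
critical spaces*, arXiv:2101.08586, Thm. 1 with `q = 3`), which at `q = 3` runs T. Tao's main
estimate (arXiv:1908.04958v2, Thm. 5.1) in cylindrical geometry.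

Tao, p. 39 (proof of Thm. 5.1, case (5.11)), quoted in `TaoMainEstimateShellStep.lean`, locates
from a mass lower bound on `[−T₂/C₀, 0] × {R' ≤ |x| ≤ 2R'}` a dyadic time scale
`exp(−20(R')²/T₂)T₂ ≤ t₀ ≤ T₂/C₀` (5.14) and, "covering the annulus `R' ≤ |x| ≤ 2R'` by
`O(exp(O((R')²/T₂)))` balls of radius `t₀^{1/2}`", a ball `B(x_*, t₀^{1/2})` carrying
`exp(−O((R')²/T₂))` of the mass (5.15). Palasek, §5, proof of Prop. 11 (the case where `X`
dominates), performs the same two pigeonholes with the annulus replaced by a truncated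
cylindrical cell `S(ρ, 2ρ; z, 2z) = {ρ ≤ r ≤ 2ρ, z ≤ |x₃| ≤ 2z}`: "By an analogous argument using
(regularity), the upper time limit in the integral can be shortened to
`−(T₂^{5/2}/(ρ²z)) e^{−O(ρ²+z²)/T₂}` which, by Young's inequality, is less than
`−T₂e^{−O(ρ²+z²)/T₂}`. ... The interval `[−T₂/C₀, −e^{−O(ρ²+z²)/T₂}T₂]` can be covered by
`O((ρ²+z²)/T₂)` intervals of the form `[−2t₀, −t₀]` so by the pigeonhole principle, there exists
a `t₀ ∈ [e^{−O(ρ²+z²)/T₂}T₂, T₂/C₀]` such that [the cell carries the mass on `[−2t₀, −t₀]`].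
Moreover, since `t₀ ≥ e^{−O(ρ²+z²)/T₂}T₂`, the spatial domain of integration can be covered by
`e^{O(ρ²+z²)/T₂}T₂^{−3/2}ρ²z`, which again is smaller than `e^{O(ρ²+z²)/T₂}`, balls of radius
`t₀^{1/2}`. Therefore there exists an `x_*` in the region `S(ρ, 2ρ; z, 2z)` such that
`∫_{−2t₀}^{−t₀}∫_{B(x_*,t₀^{1/2})} (T₂⁻¹|ω|² + |∇ω|²) dx dt ≳ T₂^{−1/2}exp(−O(|x_*|²)/T₂)`.

`IsClassicalNSSolutionOn.exists_concentration_ball_of_set` is the common abstraction: the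
statement and proof of the tree's `IsClassicalNSSolutionOn.exists_concentration_ball`
(`TaoMainEstimateShellStep.lean`) with the dyadic shell replaced by an **arbitrary measurable
set `S ⊆ B(0, 2R')`** on which the bounds (5.10) `|ω| ≤ T⁻¹`, `|∇ω| ≤ T^{-3/2}` hold: from a
lower bound `V` for the mass of `F = (T/C₀)⁻¹|ω|² + |∇ω|²` on `[0, T/C₀] × S` (backward time)
and `80(C₀+1)R'³T⁻²e^{−20R'²/T} ≤ V` it produces `t₀ ∈ [e^{−20R'²/T}T, T/C₀)` and a centre
`x_*` within `t₀^{1/2}` of a point of `S` with `V e^{−32R'²/T} ≤ ∫_{t₀}^{2t₀}∫_{B(x_*,t₀^{1/2})} F`.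
The proof is the tree's, verbatim up to the bookkeeping of `S` (short times negligible by
(5.10) and `|S| ≤ |B(0,2R')| ≤ 40R'³`; dyadic time window; grid cubes of side `t₀^{1/2}`
covering `B(0, 2R')`, `setIntegral_eq_sum_gridCubes`; counting `2m(2M+1)³ ≤ e^{32R'²/T}`).

## References

* T. Tao, arXiv:1908.04958v2 (2021), proof of Thm. 5.1, p. 39, (5.14)–(5.15).
  [Tao2021QuantitativeNS]
* S. Palasek, arXiv:2101.08586 (ARMA 242 (2021) 1479–1531), §5, proof of Prop. 11.
  [Palasek2021]
-/

noncomputable section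

open MeasureTheory Set Function Filter Topology Metric
open scoped ContDiff

namespace Literature.Analysis.FluidPDE

section SetStep

variable {b T : ℝ} {u : ℝ → EuclideanSpace ℝ (Fin 3) → EuclideanSpace ℝ (Fin 3)}
  {p : ℝ → EuclideanSpace ℝ (Fin 3) → ℝ}

set_option maxHeartbeats 1000000 in
/-- **From a bounded set to a small ball** (the time and space pigeonholes of Tao, proof of
Thm. 5.1, p. 39, (5.14)–(5.15), for an arbitrary bounded measurable set `S ⊆ B(0, 2R')` in place
of the dyadic shell `{R' ≤ |x| < 2R'}` — the form needed for the truncated cylindrical cells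
`{ρ ≤ r ≤ 2ρ, z ≤ |x₃| ≤ 2z}` of Palasek, arXiv:2101.08586, proof of Prop. 11, Step "case X");
see the module docstring. [cite: Tao2021QuantitativeNS, Thm. 5.1 proof p. 39 (5.14)-(5.15)]
[cite: Palasek2021, §5, proof of Prop. 11] -/
theorem IsClassicalNSSolutionOn.exists_concentration_ball_of_set
    (h : IsClassicalNSSolutionOn (Icc (b - T) b) 1 0 u p) (hT : 0 < T)
    {C₀ : ℝ} (hC₀ : 2 ≤ C₀) {S : Set (EuclideanSpace ℝ (Fin 3))} (hSmeas : MeasurableSet S)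
    {R' : ℝ} (hR' : 0 < R') (hSsub : S ⊆ ball 0 (2 * R'))
    (hTR' : 100 * T ≤ R' ^ 2) (hC₀e : C₀ ≤ Real.exp (R' ^ 2 / T))
    (h510 : ∀ t ∈ Icc (b - T) b, ∀ x ∈ S,
      ‖vorticity u t x‖ ≤ T⁻¹ ∧ ‖fderiv ℝ (vorticity u t) x‖ ≤ T⁻¹ * (Real.sqrt T)⁻¹)
    {V : ℝ} (hVpos : 0 < V)
    (hV : V ≤ ∫ s in (0 : ℝ)..T / C₀, ∫ x in S,
        ((T / C₀)⁻¹ * ‖vorticity u (b - s) x‖ ^ 2 + ‖fderiv ℝ (vorticity u (b - s)) x‖ ^ 2))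
    (hsmall : 80 * (C₀ + 1) * R' ^ 3 * (T ^ 2)⁻¹ * Real.exp (-(20 * R' ^ 2 / T)) ≤ V) :
    ∃ t₀ : ℝ, ∃ c : EuclideanSpace ℝ (Fin 3), T * Real.exp (-(20 * R' ^ 2 / T)) ≤ t₀ ∧ t₀ < T / C₀ ∧
      (∃ y₀ ∈ S, dist y₀ c < Real.sqrt t₀) ∧
      V * Real.exp (-(32 * R' ^ 2 / T)) ≤ ∫ s in t₀..2 * t₀, ∫ x in ball c (Real.sqrt t₀),
        ((T / C₀)⁻¹ * ‖vorticity u (b - s) x‖ ^ 2 + ‖fderiv ℝ (vorticity u (b - s)) x‖ ^ 2) := by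
  -- ### notation-free abbreviations via `obtain`
  have hab : b - T < b := by linarith
  have hC₀0 : 0 < C₀ := by linarith
  obtain ⟨τ, hτ⟩ : ∃ τ : ℝ, τ = T / C₀ := ⟨_, rfl⟩
  have hτ0 : 0 < τ := by rw [hτ]; positivity
  have h2τ : 2 * τ ≤ T := by
    rw [hτ, mul_div_assoc', div_le_iff₀ hC₀0]; nlinarith
  have hτT : τ ≤ T := by linarith
  obtain ⟨q, hq⟩ : ∃ q : ℝ, q = R' ^ 2 / T := ⟨_, rfl⟩
  have hq100 : 100 ≤ q := by rw [hq, le_div_iff₀ hT]; linarith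
  have hq0 : 0 < q := by linarith
  have hsT : 0 < Real.sqrt T := Real.sqrt_pos.2 hT
  have hsTR : Real.sqrt T ≤ R' / 10 := by
    rw [Real.sqrt_le_left (by positivity)]; nlinarith
  -- the density `F` and its regularity
  have hUinf : ContDiffOn ℝ ∞ (uncurry fun s y => vorticity u (b - s) y) (Icc 0 T ×ˢ univ) := by
    have := h.contDiffOn_backwardVorticity hab 0
    simp only [zero_add] at this
    rwa [show b - (b - T) = T by ring] at this
  have hUc : ContinuousOn (uncurry fun s y => vorticity u (b - s) y) (Icc 0 T ×ˢ univ) :=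
    hUinf.continuousOn
  have hDUc : ContinuousOn (fun z : ℝ × EuclideanSpace ℝ (Fin 3) =>
      fderiv ℝ (vorticity u (b - z.1)) z.2) (Icc 0 T ×ˢ univ) :=
    TaoCarleman.continuousOn_sliceFDeriv hT (hUinf.of_le (m := 2) (by norm_cast)) (by norm_num)
  have hFc : ContinuousOn (fun z : ℝ × EuclideanSpace ℝ (Fin 3) =>
      τ⁻¹ * ‖vorticity u (b - z.1) z.2‖ ^ 2 + ‖fderiv ℝ (vorticity u (b - z.1)) z.2‖ ^ 2)
      (Icc 0 T ×ˢ univ) :=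
    (continuousOn_const.mul (hUc.norm.pow 2)).add (hDUc.norm.pow 2)
  have hF0 : ∀ z : ℝ × EuclideanSpace ℝ (Fin 3),
      0 ≤ τ⁻¹ * ‖vorticity u (b - z.1) z.2‖ ^ 2 + ‖fderiv ℝ (vorticity u (b - z.1)) z.2‖ ^ 2 :=
    fun z => by positivity
  have hFint : ∀ {s : ℝ}, s ∈ Icc 0 T → ∀ {A : Set (EuclideanSpace ℝ (Fin 3))}, Bornology.IsBounded A →
      IntegrableOn (fun x => τ⁻¹ * ‖vorticity u (b - s) x‖ ^ 2 + ‖fderiv ℝ (vorticity u (b - s)) x‖ ^ 2) A :=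
    fun hs A hA => TaoCarleman.integrableOn_slab_slice hFc hs hA
  have hSbdd : Bornology.IsBounded S := isBounded_ball.subset hSsub
  -- (5.10) for `F` on the shell: `F ≤ (C₀ + 1) T⁻³`
  have hFbd : ∀ s ∈ Icc 0 T, ∀ y ∈ S,
      τ⁻¹ * ‖vorticity u (b - s) y‖ ^ 2 + ‖fderiv ℝ (vorticity u (b - s)) y‖ ^ 2 ≤ (C₀ + 1) * (T ^ 3)⁻¹ := by
    intro s hs y hy
    have ht : b - s ∈ Icc (b - T) b := ⟨by linarith [hs.2], by linarith [hs.1]⟩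
    obtain ⟨hω, hDω⟩ := h510 (b - s) ht y hy
    have h1 : ‖vorticity u (b - s) y‖ ^ 2 ≤ (T⁻¹) ^ 2 := pow_le_pow_left₀ (norm_nonneg _) hω 2
    have h2 : ‖fderiv ℝ (vorticity u (b - s)) y‖ ^ 2 ≤ (T⁻¹ * (Real.sqrt T)⁻¹) ^ 2 :=
      pow_le_pow_left₀ (norm_nonneg _) hDω 2
    have h3 : (T⁻¹ * (Real.sqrt T)⁻¹) ^ 2 = (T ^ 3)⁻¹ := by
      rw [mul_pow, inv_pow, inv_pow, Real.sq_sqrt hT.le]; field_simp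
    have h4 : τ⁻¹ * (T⁻¹) ^ 2 = C₀ * (T ^ 3)⁻¹ := by rw [hτ]; field_simp
    calc τ⁻¹ * ‖vorticity u (b - s) y‖ ^ 2 + ‖fderiv ℝ (vorticity u (b - s)) y‖ ^ 2
        ≤ τ⁻¹ * (T⁻¹) ^ 2 + (T⁻¹ * (Real.sqrt T)⁻¹) ^ 2 := by gcongr
      _ = (C₀ + 1) * (T ^ 3)⁻¹ := by rw [h3, h4]; ring
  -- the shell mass `hS s = ∫_S F(s, ·)` is continuous on `[0, T]`
  have hScont : ContinuousOn (fun s => ∫ x in S,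
      (τ⁻¹ * ‖vorticity u (b - s) x‖ ^ 2 + ‖fderiv ℝ (vorticity u (b - s)) x‖ ^ 2)) (Icc 0 T) :=
    TaoCarleman.continuousOn_setIntegral_slice hSmeas hSbdd (hFc.mono (prod_mono subset_rfl (subset_univ _)))
  have hS0 : ∀ s, 0 ≤ ∫ x in S,
      (τ⁻¹ * ‖vorticity u (b - s) x‖ ^ 2 + ‖fderiv ℝ (vorticity u (b - s)) x‖ ^ 2) :=
    fun s => setIntegral_nonneg hSmeas fun x _ => hF0 (s, x)
  rw [← hτ] at hV
  -- ### Step C: the short times are negligible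
  obtain ⟨θ, hθ⟩ : ∃ θ : ℝ, θ = T * Real.exp (-(20 * R' ^ 2 / T)) := ⟨_, rfl⟩
  have hθ0 : 0 < θ := by rw [hθ]; positivity
  have hθτ : θ ≤ τ := by
    rw [hθ, hτ, le_div_iff₀ hC₀0]
    have h1 : C₀ * Real.exp (-(20 * R' ^ 2 / T)) ≤ 1 := by
      have h2 : Real.exp (R' ^ 2 / T) ≤ Real.exp (20 * R' ^ 2 / T) :=
        Real.exp_le_exp.2 (by rw [mul_div_assoc, ← hq]; linarith)
      have h3 : Real.exp (20 * R' ^ 2 / T) * Real.exp (-(20 * R' ^ 2 / T)) = 1 := by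
        rw [← Real.exp_add]; simp
      nlinarith [hC₀e, h2, Real.exp_pos (-(20 * R' ^ 2 / T))]
    nlinarith [h1, hT]
  have hvolS : (volume S).toReal
      ≤ 40 * R' ^ 3 := by
    have h1 : volume S ≤
        ENNReal.ofReal (5 * (2 * R') ^ 3) :=
      (measure_mono hSsub).trans (volume_ball_le_five_mul_cube 0 (by positivity))
    have := ENNReal.toReal_mono ENNReal.ofReal_ne_top h1
    rw [ENNReal.toReal_ofReal (by positivity)] at this
    linarith
  have hSle : ∀ s ∈ Icc 0 T, ∫ x in S,
      (τ⁻¹ * ‖vorticity u (b - s) x‖ ^ 2 + ‖fderiv ℝ (vorticity u (b - s)) x‖ ^ 2) ≤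
      (C₀ + 1) * (T ^ 3)⁻¹ * (40 * R' ^ 3) := by
    intro s hs
    have hμ : volume S < ⊤ :=
      (measure_mono hSsub).trans_lt measure_ball_lt_top
    have hI := norm_setIntegral_le_of_norm_le_const hμ (fun y hy => by
      rw [Real.norm_of_nonneg (hF0 (s, y))]; exact hFbd s hs y hy)
    exact (Real.le_norm_self _).trans (hI.trans (mul_le_mul_of_nonneg_left hvolS (by positivity)))
  have hshort : ∫ s in (0 : ℝ)..θ, ∫ x in S,
      (τ⁻¹ * ‖vorticity u (b - s) x‖ ^ 2 + ‖fderiv ℝ (vorticity u (b - s)) x‖ ^ 2) ≤ V / 2 := by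
    have hθT : θ ≤ T := hθτ.trans hτT
    have h1 := intervalIntegral.norm_integral_le_of_norm_le_const (a := 0) (b := θ)
      (C := (C₀ + 1) * (T ^ 3)⁻¹ * (40 * R' ^ 3))
      (f := fun s => ∫ x in S,
        (τ⁻¹ * ‖vorticity u (b - s) x‖ ^ 2 + ‖fderiv ℝ (vorticity u (b - s)) x‖ ^ 2))
      (fun s hs => by
        rw [uIoc_of_le hθ0.le] at hs
        rw [Real.norm_of_nonneg (hS0 s)]
        exact hSle s ⟨hs.1.le, hs.2.trans hθT⟩)
    rw [sub_zero, abs_of_pos hθ0] at h1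
    refine (Real.le_norm_self _).trans (h1.trans ?_)
    rw [hθ]
    have : (C₀ + 1) * (T ^ 3)⁻¹ * (40 * R' ^ 3) * (T * Real.exp (-(20 * R' ^ 2 / T))) =
        (80 * (C₀ + 1) * R' ^ 3 * (T ^ 2)⁻¹ * Real.exp (-(20 * R' ^ 2 / T))) / 2 := by
      field_simp; ring
    rw [this]
    linarith
  have hint : ∀ {c d : ℝ}, 0 ≤ c → c ≤ d → d ≤ T → IntervalIntegrable (fun s => ∫ x in
      S,
      (τ⁻¹ * ‖vorticity u (b - s) x‖ ^ 2 + ‖fderiv ℝ (vorticity u (b - s)) x‖ ^ 2)) volume c d :=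
    fun hc hcd hd => (hScont.mono (Icc_subset_Icc hc hd)).intervalIntegrable_of_Icc hcd
  have hlong : V / 2 ≤ ∫ s in θ..τ, ∫ x in S,
      (τ⁻¹ * ‖vorticity u (b - s) x‖ ^ 2 + ‖fderiv ℝ (vorticity u (b - s)) x‖ ^ 2) := by
    have := intervalIntegral.integral_add_adjacent_intervals (hint le_rfl hθ0.le (hθτ.trans hτT))
      (hint hθ0.le hθτ hτT)
    linarith
  -- ### Step D: the dyadic time window
  obtain ⟨m, hm⟩ : ∃ m : ℕ, m = ⌈30 * q⌉₊ := ⟨_, rfl⟩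
  have hmq : (m : ℝ) ≤ 31 * q := by
    have := Nat.ceil_lt_add_one (by positivity : (0 : ℝ) ≤ 30 * q)
    rw [← hm] at this; linarith
  have hmge : 30 * q ≤ m := by rw [hm]; exact Nat.le_ceil _
  have h2m : τ ≤ 2 ^ m * θ := by
    -- `2^m ≥ e^{20 q}` since `log 2 ≥ 2/3`
    have hlog2 : (2 : ℝ) / 3 ≤ Real.log 2 := by
      have := Real.log_two_gt_d9; linarith
    have h1 : Real.exp (20 * q) ≤ (2 : ℝ) ^ m := by
      rw [← Real.rpow_natCast, Real.rpow_def_of_pos two_pos, Real.exp_le_exp]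
      nlinarith [hmge, hlog2, hq0]
    have h2 : Real.exp (20 * q) * θ = T := by
      rw [hθ, hq, ← mul_assoc, mul_comm (Real.exp _) T, mul_assoc, ← Real.exp_add]
      simp [mul_div_assoc]
    calc τ ≤ T := hτT
      _ = Real.exp (20 * q) * θ := h2.symm
      _ ≤ 2 ^ m * θ := mul_le_mul_of_nonneg_right h1 hθ0.le
  obtain ⟨t₀, hθt₀, ht₀τ, hwin⟩ := exists_dyadic_time_window hθ0 hθτ h2m
    (hScont.mono (Icc_subset_Icc le_rfl h2τ)) (fun s _ => hS0 s) (by linarith)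
  have ht₀0 : 0 < t₀ := hθ0.trans_le hθt₀
  have h2t₀T : 2 * t₀ ≤ T := by linarith
  have hm0 : (0 : ℝ) < m := by
    have : (0 : ℝ) < 30 * q := by positivity
    linarith [hmge]
  have hwin' : V / (2 * m) ≤ ∫ s in t₀..2 * t₀, ∫ x in S,
      (τ⁻¹ * ‖vorticity u (b - s) x‖ ^ 2 + ‖fderiv ℝ (vorticity u (b - s)) x‖ ^ 2) := by
    rw [div_le_iff₀ (by positivity)]
    calc V = V / 2 * 2 := by ring
      _ ≤ (m * ∫ s in t₀..2 * t₀, ∫ x in S,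
          (τ⁻¹ * ‖vorticity u (b - s) x‖ ^ 2 + ‖fderiv ℝ (vorticity u (b - s)) x‖ ^ 2)) * 2 := by
          nlinarith [hlong, hwin]
      _ = _ := by ring
  -- ### Step E: the grid cubes of side `δ = √t₀`
  obtain ⟨δ, hδ⟩ : ∃ δ : ℝ, δ = Real.sqrt t₀ := ⟨_, rfl⟩
  have hδ0 : 0 < δ := by rw [hδ]; exact Real.sqrt_pos.2 ht₀0
  have hδT : δ ≤ Real.sqrt T := by rw [hδ]; exact Real.sqrt_le_sqrt (by linarith)
  have hδR : δ ≤ R' / 10 := hδT.trans hsTR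
  obtain ⟨M, hM⟩ : ∃ M : ℕ, M = ⌈2 * R' / δ⌉₊ + 1 := ⟨_, rfl⟩
  have hMge : 2 * R' / δ + 1 ≤ M := by
    rw [hM, Nat.cast_add, Nat.cast_one]
    have := Nat.le_ceil (2 * R' / δ)
    linarith
  have hMle : (M : ℝ) ≤ 2 * R' / δ + 2 := by
    rw [hM, Nat.cast_add, Nat.cast_one]
    have := Nat.ceil_lt_add_one (by positivity : (0 : ℝ) ≤ 2 * R' / δ)
    linarith
  -- the cube pieces and their time integrals
  have hGcont : ∀ κ : Fin 3 → ℤ, ContinuousOn (fun s => ∫ x in S ∩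
        {z : EuclideanSpace ℝ (Fin 3) | ∀ i, δ * (κ i : ℝ) ≤ z i ∧ z i < δ * (κ i : ℝ) + δ},
      (τ⁻¹ * ‖vorticity u (b - s) x‖ ^ 2 + ‖fderiv ℝ (vorticity u (b - s)) x‖ ^ 2)) (Icc 0 T) :=
    fun κ => TaoCarleman.continuousOn_setIntegral_slice (hSmeas.inter (measurableSet_gridCube δ κ))
      (hSbdd.subset inter_subset_left) (hFc.mono (prod_mono subset_rfl (subset_univ _)))
  have hsumeq : ∀ s ∈ Icc t₀ (2 * t₀), ∫ x in S,
      (τ⁻¹ * ‖vorticity u (b - s) x‖ ^ 2 + ‖fderiv ℝ (vorticity u (b - s)) x‖ ^ 2) ≤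
      ∑ κ ∈ Fintype.piFinset (fun _ : Fin 3 => Finset.Icc (-(M : ℤ)) M),
        ∫ x in S ∩
          {z : EuclideanSpace ℝ (Fin 3) | ∀ i, δ * (κ i : ℝ) ≤ z i ∧ z i < δ * (κ i : ℝ) + δ},
        (τ⁻¹ * ‖vorticity u (b - s) x‖ ^ 2 + ‖fderiv ℝ (vorticity u (b - s)) x‖ ^ 2) := by
    intro s hs
    have hs' : s ∈ Icc 0 T := ⟨ht₀0.le.trans hs.1, hs.2.trans h2t₀T⟩
    exact (setIntegral_eq_sum_gridCubes hSmeas hδ0 hMge hSsub (hFint hs' hSbdd)).le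
  have hne : (Fintype.piFinset (fun _ : Fin 3 => Finset.Icc (-(M : ℤ)) M)).Nonempty :=
    ⟨fun _ => 0, Fintype.mem_piFinset.2 fun _ => Finset.mem_Icc.2 ⟨by simp, by simp⟩⟩
  obtain ⟨κ, -, hκ⟩ := exists_intervalIntegral_le_card_mul hne (by linarith : t₀ ≤ 2 * t₀)
    (hint ht₀0.le (by linarith) h2t₀T)
    (fun κ _ => ((hGcont κ).mono (Icc_subset_Icc ht₀0.le h2t₀T)).intervalIntegrable_of_Icc (by linarith))
    hsumeq
  rw [card_piFinset_Icc] at hκ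
  -- the cardinality bound `(2M+1)³ ≤ 125 q^{3/2} e^{30q}`
  have hδlow : Real.sqrt T * Real.exp (-(10 * q)) ≤ δ := by
    rw [hδ]
    have : Real.sqrt θ = Real.sqrt T * Real.exp (-(10 * q)) := by
      rw [hθ, Real.sqrt_mul hT.le, hq]
      congr 1
      rw [show -(20 * R' ^ 2 / T) = ((2 : ℕ) : ℝ) * (-(10 * (R' ^ 2 / T))) by push_cast; ring,
        Real.exp_nat_mul, Real.sqrt_sq (Real.exp_pos _).le]
    rw [← this]; exact Real.sqrt_le_sqrt hθt₀
  have hsq : Real.sqrt q = R' / Real.sqrt T := by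
    rw [hq, Real.sqrt_div (sq_nonneg R'), Real.sqrt_sq hR'.le]
  have hsq10 : 10 ≤ Real.sqrt q := (Real.le_sqrt' (by norm_num)).2 (by nlinarith [hq100])
  have hsq0 : 0 < Real.sqrt q := by linarith
  have he10 : 1 ≤ Real.exp (10 * q) := Real.one_le_exp (by positivity)
  have hRδ : 2 * R' / δ ≤ 2 * Real.sqrt q * Real.exp (10 * q) := by
    rw [div_le_iff₀ hδ0, hsq]
    have hE : Real.exp (10 * q) * Real.exp (-(10 * q)) = 1 := by rw [← Real.exp_add]; simp
    calc 2 * R' = 2 * (R' / Real.sqrt T) * Real.exp (10 * q) * (Real.sqrt T * Real.exp (-(10 * q))) := by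
          have : 2 * (R' / Real.sqrt T) * Real.exp (10 * q) * (Real.sqrt T * Real.exp (-(10 * q))) =
              2 * R' * (Real.exp (10 * q) * Real.exp (-(10 * q))) * (Real.sqrt T / Real.sqrt T) := by ring
          rw [this, hE, div_self hsT.ne', mul_one, mul_one]
      _ ≤ 2 * (R' / Real.sqrt T) * Real.exp (10 * q) * δ := by gcongr
  have h2M1 : (2 * M + 1 : ℝ) ≤ 5 * Real.sqrt q * Real.exp (10 * q) := by
    have h5 : (5 : ℝ) ≤ Real.sqrt q * Real.exp (10 * q) := by nlinarith [hsq10, he10]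
    nlinarith [hMle, hRδ, h5]
  have hcard : ((2 * M + 1) ^ 3 : ℕ) ≤ (125 * (q * Real.sqrt q) * Real.exp (30 * q) : ℝ) := by
    have h1 : (2 * (M : ℝ) + 1) ^ 3 ≤ (5 * Real.sqrt q * Real.exp (10 * q)) ^ 3 :=
      pow_le_pow_left₀ (by positivity) h2M1 3
    have h2 : (5 * Real.sqrt q * Real.exp (10 * q)) ^ 3 = 125 * (q * Real.sqrt q) * Real.exp (30 * q) := by
      have hs3 : Real.sqrt q ^ 3 = q * Real.sqrt q := by
        rw [pow_succ, Real.sq_sqrt hq0.le]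
      have he3 : Real.exp (10 * q) ^ 3 = Real.exp (30 * q) := by
        rw [← Real.exp_nat_mul]; congr 1; push_cast; ring
      rw [mul_pow, mul_pow, hs3, he3]; norm_num
    push_cast
    rw [← h2]; exact h1
  -- the selected cube carries `≥ V e^{-32 q}`
  have hcount : 2 * (m : ℝ) * ((2 * M + 1) ^ 3 : ℕ) ≤ Real.exp (32 * q) := by
    have hsqq : Real.sqrt q ≤ q := by
      rw [Real.sqrt_le_left hq0.le]; nlinarith
    have h1 : 2 * (m : ℝ) * ((2 * M + 1) ^ 3 : ℕ) ≤ 2 * (31 * q) * (125 * (q * Real.sqrt q) * Real.exp (30 * q)) :=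
      mul_le_mul (by linarith) hcard (by positivity) (by positivity)
    have h2 : 2 * (31 * q) * (125 * (q * Real.sqrt q) * Real.exp (30 * q)) ≤
        7750 * q ^ 3 * Real.exp (30 * q) := by
      have := mul_le_mul_of_nonneg_left hsqq (by positivity : (0 : ℝ) ≤ 7750 * q ^ 2 * Real.exp (30 * q))
      nlinarith [this]
    have h3 : 7750 * q ^ 3 * Real.exp (30 * q) ≤ Real.exp (32 * q) := by
      rw [show 32 * q = 2 * q + 30 * q by ring, Real.exp_add]
      exact mul_le_mul_of_nonneg_right (mul_pow_three_le_exp_two_mul hq100) (Real.exp_pos _).le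
    linarith
  have hGκ : V * Real.exp (-(32 * R' ^ 2 / T)) ≤ ∫ s in t₀..2 * t₀, ∫ x in S ∩
        {z : EuclideanSpace ℝ (Fin 3) | ∀ i, δ * (κ i : ℝ) ≤ z i ∧ z i < δ * (κ i : ℝ) + δ},
      (τ⁻¹ * ‖vorticity u (b - s) x‖ ^ 2 + ‖fderiv ℝ (vorticity u (b - s)) x‖ ^ 2) := by
    have hE : Real.exp (32 * q) * Real.exp (-(32 * R' ^ 2 / T)) = 1 := by
      rw [hq, ← Real.exp_add]; simp [mul_div_assoc]
    have h1 : V ≤ 2 * (m : ℝ) * ((2 * M + 1) ^ 3 : ℕ) * ∫ s in t₀..2 * t₀, ∫ x in S ∩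
          {z : EuclideanSpace ℝ (Fin 3) | ∀ i, δ * (κ i : ℝ) ≤ z i ∧ z i < δ * (κ i : ℝ) + δ},
        (τ⁻¹ * ‖vorticity u (b - s) x‖ ^ 2 + ‖fderiv ℝ (vorticity u (b - s)) x‖ ^ 2) := by
      rw [div_le_iff₀ (by positivity)] at hwin'
      calc V ≤ (∫ s in t₀..2 * t₀, ∫ x in S,
            (τ⁻¹ * ‖vorticity u (b - s) x‖ ^ 2 + ‖fderiv ℝ (vorticity u (b - s)) x‖ ^ 2)) * (2 * m) := hwin'
        _ ≤ _ := by nlinarith [hκ, hm0]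
    -- positivity of the selected integral
    have hI0 : 0 ≤ ∫ s in t₀..2 * t₀, ∫ x in S ∩
          {z : EuclideanSpace ℝ (Fin 3) | ∀ i, δ * (κ i : ℝ) ≤ z i ∧ z i < δ * (κ i : ℝ) + δ},
        (τ⁻¹ * ‖vorticity u (b - s) x‖ ^ 2 + ‖fderiv ℝ (vorticity u (b - s)) x‖ ^ 2) :=
      intervalIntegral.integral_nonneg (by linarith) fun s _ =>
        setIntegral_nonneg (hSmeas.inter (measurableSet_gridCube δ κ)) fun x _ => hF0 (s, x)
    have h2 := mul_le_mul_of_nonneg_right hcount hI0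
    calc V * Real.exp (-(32 * R' ^ 2 / T)) ≤ (Real.exp (32 * q) * ∫ s in t₀..2 * t₀, ∫ x in
          S ∩
            {z : EuclideanSpace ℝ (Fin 3) | ∀ i, δ * (κ i : ℝ) ≤ z i ∧ z i < δ * (κ i : ℝ) + δ},
          (τ⁻¹ * ‖vorticity u (b - s) x‖ ^ 2 + ‖fderiv ℝ (vorticity u (b - s)) x‖ ^ 2)) *
          Real.exp (-(32 * R' ^ 2 / T)) :=
          mul_le_mul_of_nonneg_right (h1.trans (by linarith [h2])) (Real.exp_pos _).le
      _ = _ := by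
          rw [mul_comm (Real.exp (32 * q)), mul_assoc, hE, mul_one]
  -- ### the centre: the selected cube meets the shell
  have hVe : 0 < V * Real.exp (-(32 * R' ^ 2 / T)) := by positivity
  have hne' : (S ∩
      {z : EuclideanSpace ℝ (Fin 3) | ∀ i, δ * (κ i : ℝ) ≤ z i ∧ z i < δ * (κ i : ℝ) + δ}).Nonempty := by
    by_contra hemp
    rw [Set.not_nonempty_iff_eq_empty] at hemp
    rw [hemp] at hGκ
    simp only [Measure.restrict_empty, integral_zero_measure, intervalIntegral.integral_zero] at hGκ
    linarith
  obtain ⟨y₀, hy₀S, hy₀Q⟩ := hne'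
  obtain ⟨c, hc⟩ : ∃ c : EuclideanSpace ℝ (Fin 3), c = WithLp.toLp 2 fun i => δ * (κ i : ℝ) + δ / 2 :=
    ⟨_, rfl⟩
  have hQball : {z : EuclideanSpace ℝ (Fin 3) | ∀ i, δ * (κ i : ℝ) ≤ z i ∧ z i < δ * (κ i : ℝ) + δ} ⊆
      ball c δ := by rw [hc]; exact gridCube_subset_ball hδ0 κ
  have hy₀c : ‖y₀ - c‖ < δ := by
    have := hQball hy₀Q
    rwa [mem_ball, dist_eq_norm] at this
  -- ### the mass on the ball `B(c, δ)`
  have hballcont : ContinuousOn (fun s => ∫ x in ball c δ,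
      (τ⁻¹ * ‖vorticity u (b - s) x‖ ^ 2 + ‖fderiv ℝ (vorticity u (b - s)) x‖ ^ 2)) (Icc 0 T) :=
    TaoCarleman.continuousOn_setIntegral_slice measurableSet_ball isBounded_ball
      (hFc.mono (prod_mono subset_rfl (subset_univ _)))
  have hball : ∫ s in t₀..2 * t₀, ∫ x in S ∩
        {z : EuclideanSpace ℝ (Fin 3) | ∀ i, δ * (κ i : ℝ) ≤ z i ∧ z i < δ * (κ i : ℝ) + δ},
      (τ⁻¹ * ‖vorticity u (b - s) x‖ ^ 2 + ‖fderiv ℝ (vorticity u (b - s)) x‖ ^ 2) ≤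
      ∫ s in t₀..2 * t₀, ∫ x in ball c δ,
        (τ⁻¹ * ‖vorticity u (b - s) x‖ ^ 2 + ‖fderiv ℝ (vorticity u (b - s)) x‖ ^ 2) := by
    refine intervalIntegral.integral_mono_on (by linarith)
      (((hGcont κ).mono (Icc_subset_Icc ht₀0.le h2t₀T)).intervalIntegrable_of_Icc (by linarith))
      ((hballcont.mono (Icc_subset_Icc ht₀0.le h2t₀T)).intervalIntegrable_of_Icc (by linarith))
      fun s hs => ?_
    have hs' : s ∈ Icc 0 T := ⟨ht₀0.le.trans hs.1, hs.2.trans h2t₀T⟩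
    exact setIntegral_mono_set (hFint hs' isBounded_ball)
      (Eventually.of_forall fun x => hF0 (s, x))
      (Eventually.of_forall (inter_subset_right.trans hQball))
  refine ⟨t₀, c, hθ ▸ hθt₀, hτ ▸ ht₀τ, ⟨y₀, hy₀S, by rwa [dist_eq_norm, ← hδ]⟩, ?_⟩
  rw [← hτ, ← hδ]
  exact hGκ.trans hball


end SetStep

end Literature.Analysis.FluidPDE

end
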